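import Mathlib
import Summits.Ventures.HodgeRepro.Tier4.Line4.HorbMain
import Summits.Ventures.HodgeRepro.Tier4.Line4.LevelIndicator
import Summits.Ventures.HodgeRepro.Tier4.Line4.NaturalWitnessMu
import Summits.Ventures.HodgeRepro.Tier4.Line4.GASplit
import Summits.Ventures.HodgeRepro.Tier4.Line4.ConvProduct
import Summits.Ventures.HodgeRepro.Tier4.Line4.L1Class

/-!
# Tier4/Line4/MainTermInstance — C-L4-MAIN-INSTANCE: the display (S-MAIN) of the (7b) glue as a theorem modulo the
chain's displayed integrabilities, the phase alignment and the archimedean non-vanishing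

Blind re-derivation cell `pub-hodge-repro`, Tier 4 «prove the step» (README §9–§10), seat t4-L4-p1 (prover, LINE L4,
gen 4; plan-4 g5's cut S15435).  Tree path `lean/Summits/Ventures/HodgeRepro/Tier4/Line4/MainTermInstance.lean`.
Mathlib-level; no literature.

WHAT IS PROVED.  x2's (7b) glue `exists_levelFamily_fibreDominated_of_displays` (TailGlue) displays (S-MAIN):
`hmain : ∃ m > 0, ∃ N₁, ∀ N ≥ N₁, m · (C′ · suppMeasure (p^{N+n₁}) γ₀) ≤ ‖S.orbital χ χ′ (orbitOf γ₀) (f N)‖` for the witness of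
record `f N := S.conv (prodFn finf (ffinMuNat μ₀ γ₀ lev (lev N))) (testNat e (lev N))`, `lev N := p^{N+n₁}`.  Here it is a
THEOREM (`main_term_of_displays`) from
* the product structure of `f N` — by CONVPROD (`conv_eq_mul_of_isProductFn'`, no integrability): `f N = F_∞ ⊗ F_f` with
  the LEVEL-INDEPENDENT archimedean factor `F_∞ = c₀ · (finf ∗ e)` (`convInf`, Haar normalisation `c₀` of `G(𝔸)`, GASplit)
  and the finite factor `F_f = ffinMu (lev N) ∗ 1_{K(lev N)} = levelDC (lev N)` EXACTLY (L2-p1's `convFin_ffinMu_levelInd`);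
* L2-p1's chain lower bound `norm_orbital_ge_of_chain` (HorbMain) at `F := f N`, whose CONV-Z / UNFOLD-Z / PRODINT
  integrability and summability inputs are DISPLAYED here, bundled as `ChainInputs` (one instance per level — the PRINT
  RULE: these are the `L¹` integrabilities of the non-compactly-supported witness, INTEG's (A1)–(A4)/(B1)–(B4)/(C)/(D) shapes);
* the finite main term `∫_{DZ_f × T′_f} Re levelDC(b⁻¹ γ₀ b′) = suppMeasure (lev N) γ₀` (`setIntegral_re_levelDC_eq_suppMeasure`,
  the indicator computation of L2-p1's `re_setIntegral_chi_innerFin_levelDC_ge_suppMeasure` exported);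
* the archimedean factor `∫_{T_∞} χ · innerInf F_∞ γ₀ = c₀ · archFactor (finf ∗ e) γ₀` (`integral_chi_innerInf_eq_archFactor`:
  `convInf` sees the archimedean part only, `convInf_ofInfPart`), NON-ZERO by the displayed `harch` — which is exactly the
  third conjunct of L1-p1's `exists_infFactor_of_isArchCoeff` (ArchApproxGlue) for the `e` of record;
* the phase alignment `hδ` on the level fibre with `0 < δ` (displayed, W0REL) and `0 < C′`.
The constant is `m := c · c′ · c₀ · ‖archFactor (finf ∗ e) γ₀‖ · δ / C′` and `N₁ := 0`.
NOT here: the integrability displays themselves (L¹-class INTEG for the witness), `hδ`, `hDZ`.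

Nothing here says anything about the status of the Hodge conjecture for CM abelian varieties, which is NOT proved
(HC_CM is NOT proved by anyone in this repository).
-/

set_option autoImplicit false

noncomputable section

namespace Summit.Ventures.HodgeRepro.Tier4.Line4

open Summit.Ventures.HodgeRepro.Tier4 Summit.Ventures.HodgeRepro.Tier4.Common
  Summit.Ventures.HodgeRepro.Tier4.Line1 MeasureTheory
open scoped ComplexConjugate Topology Pointwise NNReal

section Inputs

variable {k : Type} [Field k] [NumberField k] (W : PlaneData k) [MeasurableSpace (GA W)] [BorelSpace (GA W)]
  (R : RTFData W)

/-- **The chain's displayed integrability and summability inputs** for a product test function `F = F_∞ ⊗ F_f` at the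
regular rational `γ₀` — the binders (A1)–(A4), `hs`, (B1)–(B4), `hA`, `hB`, `hIinf`, `hIfin`, `hint` of L2-p1's
`norm_orbital_ge_of_chain` (HorbMain), bundled; for a compactly supported `F` they are INTEG's theorems (HorbLevel's
`norm_orbital_ge_of_integ`), for the `L¹` witness of record they are DISPLAYED (the PRINT RULE). -/
structure ChainInputs (γ₀ : rationalPoints W)
    (νinf : Measure (torusInf W)) (νf : Measure (torusFin W))
    (νinf' : Measure (torusInf' W)) (νf' : Measure (torusFin' W)) (DZf : Set (torusFin W))
    (F Finf Ffin : GA W → ℂ) : Prop where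
  hA1 : ∀ (γ : rationalPoints W) (t : torusT W), Integrable (innerFn W R F (γ : GA W) t) (R.μT'.restrict R.DT')
  hA2 : ∀ t : torusT W, Summable (fun γ : Set.range (orbitMap W γ₀) =>
    ∫ t' in R.DT', ‖innerFn W R F ((γ : rationalPoints W) : GA W) t t'‖ ∂(R.μT'))
  hA3 : ∀ γ : rationalPoints W,
    Integrable (fun t : torusT W => R.chi t * innerInt W R F (γ : GA W) t) (R.μT.restrict R.DT)
  hA4 : Summable (fun γ : Set.range (orbitMap W γ₀) =>
    ∫ t in R.DT, ‖R.chi t * innerInt W R F ((γ : rationalPoints W) : GA W) t‖ ∂(R.μT))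
  hs : Summable (fun γ : Set.range (orbitMap W γ₀) => R.orbitalc ((γ : rationalPoints W) : GA W) F)
  hB1 : IntegrableOn (fun t : torusT W => R.chi t * innerFull W R F (γ₀ : GA W) t) (prodDomain W DZf) R.μT
  hB2 : ∀ s : torusT W, Integrable (innerFn W R F (γ₀ : GA W) s) R.μT'
  hB3 : ∀ (δ : rationalOf W (torusT W)) (δ' : rationalOf W (torusT' W)),
    Integrable (fun t : torusT W =>
      R.chi t * innerInt W R F (((δ : torusT W) : GA W)⁻¹ * (γ₀ : GA W) * ((δ' : torusT' W) : GA W)) t)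
      (R.μT.restrict R.DT)
  hB4 : ∀ δ : rationalOf W (torusT W), Summable (fun δ' : rationalOf W (torusT' W) =>
    ∫ t in R.DT, ‖R.chi t * innerInt W R F (((δ : torusT W) : GA W)⁻¹ * (γ₀ : GA W) * ((δ' : torusT' W) : GA W)) t‖
      ∂(R.μT))
  hA : ∀ t : torusT W, Integrable (fun a : torusInf' W => conj (R.chi' (a : torusT' W)) *
    Finf ((GA.ofInfPart W t)⁻¹ * GA.ofInfPart W (γ₀ : GA W) * ((a : torusT' W) : GA W))) νinf'
  hB : ∀ t : torusT W, Integrable (fun b : torusFin' W => conj (R.chi' (b : torusT' W)) *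
    Ffin ((GA.ofFinPart W t)⁻¹ * GA.ofFinPart W (γ₀ : GA W) * ((b : torusT' W) : GA W))) νf'
  hIinf : Integrable (fun a : torusInf W => R.chi a * innerInf W R Finf (γ₀ : GA W) νinf' a) νinf
  hIfin : IntegrableOn (fun b : torusFin W => R.chi b * innerFin W R Ffin (γ₀ : GA W) νf' b) DZf νf
  hint : IntegrableOn (fun p : torusFin W × torusFin' W => R.chi p.1 * conj (R.chi' p.2) *
    Ffin ((((p.1 : torusT W) : GA W))⁻¹ * GA.ofFinPart W (γ₀ : GA W) * ((p.2 : torusT' W) : GA W)))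
    (DZf ×ˢ Set.univ) (νf.prod νf')

end Inputs

section Factors

variable {k : Type} [Field k] [NumberField k] (W : PlaneData k) [MeasurableSpace (GA W)] [BorelSpace (GA W)]

/-- **The convolution of two product functions as a product function, NO integrability** (the `isProductFn_conv` of
ConvProduct through the unconditional identity). -/
theorem isProductFn_conv' (μ : Measure (GA W))
    (μinf : Measure (infinitePart W)) [μinf.IsHaarMeasure] (μfin : Measure (finitePart W)) [μfin.IsHaarMeasure]
    (c : ℝ≥0) (hc : μ = c • Measure.map (gaSplit W).symm (μinf.prod μfin))
    {e einf efin f finf ffin : GA W → ℂ} (he : IsProductFn W e einf efin) (hf : IsProductFn W f finf ffin) :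
    IsProductFn W (conv W μ e f) (fun x => (c : ℂ) * convInf W μinf einf finf x) (convFin W μfin efin ffin) := by
  intro x
  rw [conv_eq_mul_of_isProductFn' W μ μinf μfin c hc he hf x]
  simp only [convInf_ofInfPart, convFin_ofFinPart]

/-- **The finite main term of the level indicator IS the support measure**: `∫_{DZ_f × T′_f} Re levelDC(b⁻¹ γ₀,f b′) =
suppMeasure N γ₀` (the indicator computation inside L2-p1's `re_setIntegral_chi_innerFin_levelDC_ge_suppMeasure`). -/
theorem setIntegral_re_levelDC_eq_suppMeasure (νf : Measure (torusFin W)) (νf' : Measure (torusFin' W))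
    (γ₀ : GA W) (DZf : Set (torusFin W)) {N : ℕ} (hN : N ≠ 0) :
    ∫ p in DZf ×ˢ Set.univ,
        (levelDC W γ₀ N ((((p.1 : torusT W) : GA W))⁻¹ * GA.ofFinPart W γ₀ * ((p.2 : torusT' W) : GA W))).re
          ∂(νf.prod νf') =
      (suppMeasure W νf νf' γ₀ DZf N γ₀).toReal := by
  have hfun : (fun p : torusFin W × torusFin' W =>
      (levelDC W γ₀ N ((((p.1 : torusT W) : GA W))⁻¹ * GA.ofFinPart W γ₀ * ((p.2 : torusT' W) : GA W))).re) =
      (suppSet W γ₀ N γ₀).indicator (fun _ => (1 : ℝ)) := by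
    funext p
    by_cases hp : p ∈ suppSet W γ₀ N γ₀
    · rw [Set.indicator_of_mem hp, levelDC_of_mem W γ₀ N (orbit_mem_finitePart W γ₀ p.1 p.2) hp, Complex.one_re]
    · rw [Set.indicator_of_notMem hp]
      have h0 : levelDC W γ₀ N ((((p.1 : torusT W) : GA W))⁻¹ * GA.ofFinPart W γ₀ * ((p.2 : torusT' W) : GA W)) = 0 := by
        by_contra h0
        exact hp (mem_levelDoubleCoset_of_levelDC_ne_zero W γ₀ N (orbit_mem_finitePart W γ₀ p.1 p.2) h0)
      rw [h0, Complex.zero_re]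
  rw [hfun, integral_indicator (measurableSet_suppSet W γ₀ hN γ₀), Measure.restrict_restrict
    (measurableSet_suppSet W γ₀ hN γ₀), setIntegral_const, smul_eq_mul, measureReal_def, mul_one]
  rfl

variable (R : RTFData W)

omit [BorelSpace (GA W)] in
/-- **The archimedean factor of the chain at `F_∞ = c₀ · (finf ∗ e)`** is `c₀ · archFactor (finf ∗ e) γ₀`: `convInf`
depends on the archimedean part only (`convInf_ofInfPart`), so `F_∞(a⁻¹ (γ₀)_∞ a′) = F_∞(a⁻¹ γ₀ a′)` on `T_∞ × T′_∞`. -/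
theorem integral_chi_innerInf_eq_archFactor (μinf : Measure (infinitePart W)) (c₀ : ℝ≥0)
    (finf e : GA W → ℂ) (γ₀ : GA W) (νinf : Measure (torusInf W)) (νinf' : Measure (torusInf' W)) :
    ∫ a : torusInf W, R.chi a * innerInf W R (fun x => (c₀ : ℂ) * convInf W μinf finf e x) γ₀ νinf' a ∂νinf =
      (c₀ : ℂ) * L1Class.archFactor W R (convInf W μinf finf e) γ₀ νinf νinf' := by
  have hpt : ∀ (a : torusInf W) (a' : torusInf' W),
      convInf W μinf finf e (((a : torusT W) : GA W)⁻¹ * GA.ofInfPart W γ₀ * ((a' : torusT' W) : GA W)) =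
        convInf W μinf finf e (((a : torusT W) : GA W)⁻¹ * γ₀ * ((a' : torusT' W) : GA W)) := by
    intro a a'
    have ha : ((a : torusT W) : GA W) ∈ infinitePart W := Subgroup.mem_subgroupOf.1 a.2
    have ha' : ((a' : torusT' W) : GA W) ∈ infinitePart W := Subgroup.mem_subgroupOf.1 a'.2
    rw [← convInf_ofInfPart, ofInfPart_mul, ofInfPart_mul, ofInfPart_inv, ofInfPart_eq_self_of_mem_infinitePart W ha,
      ofInfPart_eq_self_of_mem_infinitePart W ha', ofInfPart_eq_self_of_mem_infinitePart W
      (GA.ofInfPart_mem_infinitePart W γ₀)]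
    conv_rhs => rw [← convInf_ofInfPart, ofInfPart_mul, ofInfPart_mul, ofInfPart_inv,
      ofInfPart_eq_self_of_mem_infinitePart W ha, ofInfPart_eq_self_of_mem_infinitePart W ha']
  unfold innerInf L1Class.archFactor
  simp_rw [hpt]
  rw [← integral_const_mul]
  refine integral_congr_ae (Filter.Eventually.of_forall fun a => ?_)
  dsimp only
  rw [mul_left_comm]
  congr 1
  rw [← integral_const_mul]
  refine integral_congr_ae (Filter.Eventually.of_forall fun a' => ?_)
  dsimp only
  ring

end Factors

section Main

variable {k : Type} [Field k] [NumberField k] (W : PlaneData k) [MeasurableSpace (GA W)] [BorelSpace (GA W)]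
  (R : RTFData W) (μ : Measure (GA W)) [μ.IsHaarMeasure] [R.μT.IsHaarMeasure] [R.μT'.IsHaarMeasure]
  (DG : Set (GA W)) (fdG : IsFundamentalDomain (rationalPoints W) DG μ) (compG : IsCompact (closure DG))
  (compT : IsCompact (closure R.DT)) (compT' : IsCompact (closure R.DT'))

/-- **C-L4-MAIN-INSTANCE — the display (S-MAIN) of the (7b) glue as a theorem.**  For the witness of record
`f N := S.conv (prodFn finf (ffinMuNat μ₀ γ₀ lev (lev N))) (testNat e (lev N))`, `lev N := p^{N+n₁}`, with the Haar
normalisations `R.μT = c • (νinf ⊗ νf)`, `R.μT′ = c′ • (νinf′ ⊗ νf′)` (TorusProduct) and `μ = c₀ • (μinf ⊗ μ₀)` (GASplit),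
the displayed chain inputs `hchain N` at `F_∞ := c₀ · (finf ∗ e)`, `F_f := levelDC (lev N)`, the phase alignment `hδ`
(`0 < δ`) and the archimedean non-vanishing `harch`:
`m · (C′ · suppMeasure (lev N) γ₀) ≤ ‖S.orbital χ χ′ (orbitOf γ₀) (f N)‖` for every `N`, with
`m := c c′ c₀ ‖archFactor (finf ∗ e) γ₀‖ δ / C′ > 0`. -/
theorem main_term_of_displays [MeasurableMul (torusT W)] [MeasurableMul (torusT' W)] (hR : R.IsHaar)
    (hc : Continuous R.chi) (hu : ∀ a, ‖R.chi a‖ = 1) (hc' : Continuous R.chi') (hu' : ∀ a, ‖R.chi' a‖ = 1)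
    (γ₀ : rationalPoints W) (hreg : IsRegularRational W γ₀)
    (νinf : Measure (torusInf W)) [νinf.IsHaarMeasure] (νf : Measure (torusFin W)) [νf.IsHaarMeasure]
    (c : ℝ≥0) (hc0 : 0 < c) (hcμ : R.μT = c • Measure.map (torusSplit W).symm (νinf.prod νf))
    (νinf' : Measure (torusInf' W)) [νinf'.IsHaarMeasure] (νf' : Measure (torusFin' W)) [νf'.IsHaarMeasure]
    (c' : ℝ≥0) (hc0' : 0 < c') (hcμ' : R.μT' = c' • Measure.map (torusSplit' W).symm (νinf'.prod νf'))
    (DZf : Set (torusFin W)) (hDZf : MeasurableSet DZf) (hfd : IsFundamentalDomain (centreFin W) DZf νf)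
    (μinf : Measure (infinitePart W)) [μinf.IsHaarMeasure] (μ₀ : Measure (finitePart W)) [μ₀.IsHaarMeasure]
    (c₀ : ℝ≥0) (hc₀ : 0 < c₀) (hcμ₀ : μ = c₀ • Measure.map (gaSplit W).symm (μinf.prod μ₀))
    (finf e : GA W → ℂ)
    (harch : L1Class.archFactor W R (convInf W μinf finf e) (γ₀ : GA W) νinf νinf' ≠ 0)
    (p n₁ : ℕ) (hp : p ≠ 0) (C' : ℝ) (hC' : 0 < C') (δ : ℝ) (hδpos : 0 < δ)
    (hδ : ∀ N : ℕ, ∀ b ∈ DZf, ∀ b' : torusFin' W,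
      levelDC W (γ₀ : GA W) (p ^ (N + n₁))
          ((((b : torusT W) : GA W))⁻¹ * GA.ofFinPart W (γ₀ : GA W) * ((b' : torusT' W) : GA W)) ≠ 0 →
        δ ≤ (R.chi b * conj (R.chi' b')).re)
    (hchain : ∀ N : ℕ, ChainInputs W R γ₀ νinf νf νinf' νf' DZf
      ((Setting.ofAdelicData W R μ DG fdG compG compT compT').conv
        (L1Class.prodFn W finf (ffinMuNat W μ₀ (γ₀ : GA W) (fun n => p ^ (n + n₁)) (p ^ (N + n₁))))
        (testNat W e (p ^ (N + n₁))))
      (fun x => (c₀ : ℂ) * convInf W μinf finf e x) (levelDC W (γ₀ : GA W) (p ^ (N + n₁)))) :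
    ∃ m : ℝ, 0 < m ∧ ∃ N₁ : ℕ, ∀ N ≥ N₁,
      m * (C' * (suppMeasure W νf νf' (γ₀ : GA W) DZf (p ^ (N + n₁)) (γ₀ : GA W)).toReal) ≤
        ‖(Setting.ofAdelicData W R μ DG fdG compG compT compT').orbital R.chi R.chi'
          ((Setting.ofAdelicData W R μ DG fdG compG compT compT').orbitOf γ₀)
          ((Setting.ofAdelicData W R μ DG fdG compG compT compT').conv
            (L1Class.prodFn W finf (ffinMuNat W μ₀ (γ₀ : GA W) (fun n => p ^ (n + n₁)) (p ^ (N + n₁))))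
            (testNat W e (p ^ (N + n₁))))‖ := by
  set AF : ℂ := L1Class.archFactor W R (convInf W μinf finf e) (γ₀ : GA W) νinf νinf' with hAF
  have hAFpos : 0 < ‖AF‖ := norm_pos_iff.2 harch
  refine ⟨(c : ℝ) * (c' : ℝ) * (c₀ : ℝ) * ‖AF‖ * δ * C'⁻¹, ?_, 0, fun N _ => ?_⟩
  · apply mul_pos _ (inv_pos.2 hC')
    apply mul_pos (mul_pos (mul_pos (mul_pos _ _) _) hAFpos) hδpos
    · exact_mod_cast hc0
    · exact_mod_cast hc0'
    · exact_mod_cast hc₀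
  -- the level and its witnesses
  have hN : p ^ (N + n₁) ≠ 0 := pow_ne_zero _ hp
  set F : GA W → ℂ := (Setting.ofAdelicData W R μ DG fdG compG compT compT').conv
    (L1Class.prodFn W finf (ffinMuNat W μ₀ (γ₀ : GA W) (fun n => p ^ (n + n₁)) (p ^ (N + n₁))))
    (testNat W e (p ^ (N + n₁))) with hFdef
  -- the product structure of `F`: archimedean factor `c₀ (finf ∗ e)`, finite factor `levelDC`
  have hF : ∀ g, F g = (fun x => (c₀ : ℂ) * convInf W μinf finf e x) (GA.ofInfPart W g) *
      levelDC W (γ₀ : GA W) (p ^ (N + n₁)) (GA.ofFinPart W g) := by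
    intro g
    have hlev : ffinMuNat W μ₀ (γ₀ : GA W) (fun n => p ^ (n + n₁)) (p ^ (N + n₁)) =
        ffinMu W μ₀ (γ₀ : GA W) (p ^ (N + n₁)) := ffinMuNat_lev W μ₀ (γ₀ : GA W) (lev := fun n => p ^ (n + n₁)) (n := N) hN
    have hprod := isProductFn_conv' W μ μinf μ₀ c₀ hcμ₀
      (L1Class.isProductFn_prodFn W finf (ffinMuNat W μ₀ (γ₀ : GA W) (fun n => p ^ (n + n₁)) (p ^ (N + n₁))))
      (L1Class.isProductFn_prodFn W e (levelInd W (p ^ (N + n₁)))) g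
    rw [hFdef, testNat_of_ne_zero W e hN]
    change conv W μ _ _ g = _
    rw [hprod, hlev, convFin_ffinMu_levelInd W (γ₀ : GA W) (p ^ (N + n₁)) μ₀ hN, levelDC_ofFinPart]
  obtain ⟨hA1, hA2, hA3, hA4, hs, hB1, hB2, hB3, hB4, hA, hB, hIinf, hIfin, hint⟩ := hchain N
  have hmain := norm_orbital_ge_of_chain W R μ DG fdG compG compT compT' hR hc hu hc' hu' F
    (fun x => (c₀ : ℂ) * convInf W μinf finf e x) (levelDC W (γ₀ : GA W) (p ^ (N + n₁))) hF γ₀ hreg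
    νinf νf c hcμ νinf' νf' c' hcμ' DZf hDZf hfd hA1 hA2 hA3 hA4 hs hB1 hB2 hB3 hB4 hA hB hIinf hIfin
    (levelDC_im W (γ₀ : GA W) (p ^ (N + n₁))) (levelDC_re_nonneg W (γ₀ : GA W) (p ^ (N + n₁))) δ (hδ N) hint
  rw [setIntegral_re_levelDC_eq_suppMeasure W νf νf' (γ₀ : GA W) DZf hN,
    integral_chi_innerInf_eq_archFactor W R μinf c₀ finf e (γ₀ : GA W) νinf νinf', norm_mul, Complex.norm_real,
    Real.norm_eq_abs, NNReal.abs_eq] at hmain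
  refine le_trans (le_of_eq ?_) hmain
  rw [← hAF, show (c : ℝ) * (c' : ℝ) * (c₀ : ℝ) * ‖AF‖ * δ * C'⁻¹ *
      (C' * (suppMeasure W νf νf' (γ₀ : GA W) DZf (p ^ (N + n₁)) (γ₀ : GA W)).toReal) =
    (c : ℝ) * (c' : ℝ) * ((c₀ : ℝ) * ‖AF‖) *
      (δ * (suppMeasure W νf νf' (γ₀ : GA W) DZf (p ^ (N + n₁)) (γ₀ : GA W)).toReal) * (C'⁻¹ * C') by ring,
    inv_mul_cancel₀ hC'.ne', mul_one]

/-- **`main_term_of_displays` with the EVENTUAL phase alignment** (plan-4 g5 S15466 (i)): `hδ` only from a level `N₀` on,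
`N₁ := N₀`; the proof is the same at each `N ≥ N₀`. -/
theorem main_term_of_displays' [MeasurableMul (torusT W)] [MeasurableMul (torusT' W)] (hR : R.IsHaar)
    (hc : Continuous R.chi) (hu : ∀ a, ‖R.chi a‖ = 1) (hc' : Continuous R.chi') (hu' : ∀ a, ‖R.chi' a‖ = 1)
    (γ₀ : rationalPoints W) (hreg : IsRegularRational W γ₀)
    (νinf : Measure (torusInf W)) [νinf.IsHaarMeasure] (νf : Measure (torusFin W)) [νf.IsHaarMeasure]
    (c : ℝ≥0) (hc0 : 0 < c) (hcμ : R.μT = c • Measure.map (torusSplit W).symm (νinf.prod νf))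
    (νinf' : Measure (torusInf' W)) [νinf'.IsHaarMeasure] (νf' : Measure (torusFin' W)) [νf'.IsHaarMeasure]
    (c' : ℝ≥0) (hc0' : 0 < c') (hcμ' : R.μT' = c' • Measure.map (torusSplit' W).symm (νinf'.prod νf'))
    (DZf : Set (torusFin W)) (hDZf : MeasurableSet DZf) (hfd : IsFundamentalDomain (centreFin W) DZf νf)
    (μinf : Measure (infinitePart W)) [μinf.IsHaarMeasure] (μ₀ : Measure (finitePart W)) [μ₀.IsHaarMeasure]
    (c₀ : ℝ≥0) (hc₀ : 0 < c₀) (hcμ₀ : μ = c₀ • Measure.map (gaSplit W).symm (μinf.prod μ₀))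
    (finf e : GA W → ℂ)
    (harch : L1Class.archFactor W R (convInf W μinf finf e) (γ₀ : GA W) νinf νinf' ≠ 0)
    (p n₁ : ℕ) (hp : p ≠ 0) (C' : ℝ) (hC' : 0 < C') (δ : ℝ) (hδpos : 0 < δ)
    (hδ : ∃ N₀ : ℕ, ∀ N ≥ N₀, ∀ b ∈ DZf, ∀ b' : torusFin' W,
      levelDC W (γ₀ : GA W) (p ^ (N + n₁))
          ((((b : torusT W) : GA W))⁻¹ * GA.ofFinPart W (γ₀ : GA W) * ((b' : torusT' W) : GA W)) ≠ 0 →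
        δ ≤ (R.chi b * conj (R.chi' b')).re)
    (hchain : ∀ N : ℕ, ChainInputs W R γ₀ νinf νf νinf' νf' DZf
      ((Setting.ofAdelicData W R μ DG fdG compG compT compT').conv
        (L1Class.prodFn W finf (ffinMuNat W μ₀ (γ₀ : GA W) (fun n => p ^ (n + n₁)) (p ^ (N + n₁))))
        (testNat W e (p ^ (N + n₁))))
      (fun x => (c₀ : ℂ) * convInf W μinf finf e x) (levelDC W (γ₀ : GA W) (p ^ (N + n₁)))) :
    ∃ m : ℝ, 0 < m ∧ ∃ N₁ : ℕ, ∀ N ≥ N₁,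
      m * (C' * (suppMeasure W νf νf' (γ₀ : GA W) DZf (p ^ (N + n₁)) (γ₀ : GA W)).toReal) ≤
        ‖(Setting.ofAdelicData W R μ DG fdG compG compT compT').orbital R.chi R.chi'
          ((Setting.ofAdelicData W R μ DG fdG compG compT compT').orbitOf γ₀)
          ((Setting.ofAdelicData W R μ DG fdG compG compT compT').conv
            (L1Class.prodFn W finf (ffinMuNat W μ₀ (γ₀ : GA W) (fun n => p ^ (n + n₁)) (p ^ (N + n₁))))
            (testNat W e (p ^ (N + n₁))))‖ := by
  obtain ⟨N₀, hδ⟩ := hδ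
  set AF : ℂ := L1Class.archFactor W R (convInf W μinf finf e) (γ₀ : GA W) νinf νinf' with hAF
  have hAFpos : 0 < ‖AF‖ := norm_pos_iff.2 harch
  refine ⟨(c : ℝ) * (c' : ℝ) * (c₀ : ℝ) * ‖AF‖ * δ * C'⁻¹, ?_, N₀, fun N hN₀ => ?_⟩
  · apply mul_pos _ (inv_pos.2 hC')
    apply mul_pos (mul_pos (mul_pos (mul_pos _ _) _) hAFpos) hδpos
    · exact_mod_cast hc0
    · exact_mod_cast hc0'
    · exact_mod_cast hc₀
  have hN : p ^ (N + n₁) ≠ 0 := pow_ne_zero _ hp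
  set F : GA W → ℂ := (Setting.ofAdelicData W R μ DG fdG compG compT compT').conv
    (L1Class.prodFn W finf (ffinMuNat W μ₀ (γ₀ : GA W) (fun n => p ^ (n + n₁)) (p ^ (N + n₁))))
    (testNat W e (p ^ (N + n₁))) with hFdef
  have hF : ∀ g, F g = (fun x => (c₀ : ℂ) * convInf W μinf finf e x) (GA.ofInfPart W g) *
      levelDC W (γ₀ : GA W) (p ^ (N + n₁)) (GA.ofFinPart W g) := by
    intro g
    have hlev : ffinMuNat W μ₀ (γ₀ : GA W) (fun n => p ^ (n + n₁)) (p ^ (N + n₁)) =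
        ffinMu W μ₀ (γ₀ : GA W) (p ^ (N + n₁)) := ffinMuNat_lev W μ₀ (γ₀ : GA W) (lev := fun n => p ^ (n + n₁)) (n := N) hN
    have hprod := isProductFn_conv' W μ μinf μ₀ c₀ hcμ₀
      (L1Class.isProductFn_prodFn W finf (ffinMuNat W μ₀ (γ₀ : GA W) (fun n => p ^ (n + n₁)) (p ^ (N + n₁))))
      (L1Class.isProductFn_prodFn W e (levelInd W (p ^ (N + n₁)))) g
    rw [hFdef, testNat_of_ne_zero W e hN]
    change conv W μ _ _ g = _
    rw [hprod, hlev, convFin_ffinMu_levelInd W (γ₀ : GA W) (p ^ (N + n₁)) μ₀ hN, levelDC_ofFinPart]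
  obtain ⟨hA1, hA2, hA3, hA4, hs, hB1, hB2, hB3, hB4, hA, hB, hIinf, hIfin, hint⟩ := hchain N
  have hmain := norm_orbital_ge_of_chain W R μ DG fdG compG compT compT' hR hc hu hc' hu' F
    (fun x => (c₀ : ℂ) * convInf W μinf finf e x) (levelDC W (γ₀ : GA W) (p ^ (N + n₁))) hF γ₀ hreg
    νinf νf c hcμ νinf' νf' c' hcμ' DZf hDZf hfd hA1 hA2 hA3 hA4 hs hB1 hB2 hB3 hB4 hA hB hIinf hIfin
    (levelDC_im W (γ₀ : GA W) (p ^ (N + n₁))) (levelDC_re_nonneg W (γ₀ : GA W) (p ^ (N + n₁))) δ (hδ N hN₀) hint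
  rw [setIntegral_re_levelDC_eq_suppMeasure W νf νf' (γ₀ : GA W) DZf hN,
    integral_chi_innerInf_eq_archFactor W R μinf c₀ finf e (γ₀ : GA W) νinf νinf', norm_mul, Complex.norm_real,
    Real.norm_eq_abs, NNReal.abs_eq] at hmain
  refine le_trans (le_of_eq ?_) hmain
  rw [← hAF, show (c : ℝ) * (c' : ℝ) * (c₀ : ℝ) * ‖AF‖ * δ * C'⁻¹ *
      (C' * (suppMeasure W νf νf' (γ₀ : GA W) DZf (p ^ (N + n₁)) (γ₀ : GA W)).toReal) =
    (c : ℝ) * (c' : ℝ) * ((c₀ : ℝ) * ‖AF‖) *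
      (δ * (suppMeasure W νf νf' (γ₀ : GA W) DZf (p ^ (N + n₁)) (γ₀ : GA W)).toReal) * (C'⁻¹ * C') by ring,
    inv_mul_cancel₀ hC'.ne', mul_one]

end Main

end Summit.Ventures.HodgeRepro.Tier4.Line4

end
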